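import Summits.BirchSwinnertonDyer.BirchSwinnertonDyer.Theorems.GenusKolyvaginAtTwoPowDvdShaCardAtTwoRTJointCountOverK
import Literature.NumberTheory.EllipticCurves.Sha
import Mathlib.GroupTheory.Torsion
import Mathlib.NumberTheory.Padics.PadicVal.Basic
import HarnessLib

/-!
# Route `GenusKolyvaginAtTwo`, LINE 18 v5 (L_T `PowDvdShaCardAtTwoRT`, stmt-BirchSwinnertonDyer-23242) — THE K-SIDE COUNT WITH ITS
# EXACT LOSS: two ladders inside subgroups `U, V ≤ A` exhibit `p^{2M₀}` in `#A · #(U ∩ V)`; DISJOINT spans give L_T's `2^{2M₀} ∣ #Ш(E_K)[2^∞]`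
# with NO genus budget, NO Milne defect, NO parity bit

Seat `bsd-line-gk2-p4` g17 (WIDTH-5 attach, cell `bsd-f1-sign2`), `--supports stmt-BirchSwinnertonDyer-23242` (helper; closes nothing).
THEOREMS ONLY (no definition, no named fact, no `sorry`); BSD is not proved by any of this; neither is L_T.

WHY (memo `Cruxes/PowDvdShaCardAtTwoRT/Lines/plus-descent-deep-onesided.md` §6).  On the deep genus regime (`B = ord₂ C(Wd) ≥ 3`) every
COUNT on the bus loses the same two bits: the two-sided ℚ-frame (gk2-p3 g18) loses `B − 1`, the K-side eigen-count J_K (gk2-p3 g20,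
`…RTJointCountOverK`) loses `ord₂ #H¹(C₂, A)`, and the cross-side count J is false.  The loss is not intrinsic to `A = Ш(E_K)[2^∞]` but
to the two EXHIBITED subgroups: if the (+)-ladder spans `U` and the (−)-ladder spans `V`, the only obstruction to Kolyvagin's
`p`-odd argument `A ⊇ U ⊕ V` is `U ∩ V` (`⊆ A^{τ=+1}[2]` for eigen-ladders at `p = 2`).  This file is that bookkeeping, sign-free and
`p`-generic, and its instantiation in L_T's own currency:

* §1 `natCard_mul_natCard_eq_natCard_sup_mul_natCard_inf` (`#U · #V = #(U ⊔ V) · #(U ⊓ V)` in an abelian group);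
  **`pow_two_mul_sum_dvd_natCard_mul_natCard_inf_of_ladders`**: families of `2m+2` independent elements of order `p^{a(2m)}` in `U`
  and of order `p^{a(2m+1)}` in `V` (`m < T`) ⟹ `p^{2 Σ_{j<2T} a j} ∣ #A · #(U ⊓ V)`; ladder form `pow_two_mul_dvd_natCard_mul_natCard_inf_of_ladders`
  (`M` antitone, `M (2T) = 0`: `p^{2·M 0} ∣ #A · #(U ⊓ V)`), valuation form `two_mul_le_padicValNat_add_padicValNat_inf_of_ladders`
  (`2·M 0 ≤ v_p #A + v_p #(U ⊓ V)` — THE LOSS IS `v_p #(U ∩ V)`, nothing else), and the disjoint case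
  **`pow_two_mul_dvd_natCard_of_disjoint_ladders`**: `U ⊓ V = ⊥ ⟹ p^{2·M 0} ∣ #A`.
* §2 L_T's currency: `E` over a number field `F` (`V : WeierstrassCurve F`), subgroups `U, U′ ≤ Ш(E/F) ≤ H¹(F, E)`, the two ladders given
  as independent families of `H¹(F, E)` inside `U`, `U′`; **`pow_two_mul_dvd_natCard_sha_of_disjoint_ladders`**:
  `Disjoint U U′ ⟹ 2^{2·M 0} ∣ #Ш(E/F)[2^∞]` — for `F = K`, `E = W_K` and `M 0 = M₀` this is the conclusion of L_T VERBATIM; and the loss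
  form `pow_two_mul_dvd_natCard_sha_mul_natCard_inf_of_ladders`: `2^{2·M 0} ∣ #Ш(E/F)[2^∞] · #(U ⊓ U′)`.
* §3 (second instalment) ladders given UPSTAIRS: `pow_two_mul_sum_dvd_natCard_mul_of_ladders_map` — through `f : G₁ → A`, `g : G₂ → A`
  the count charges `#S · #(f(U) ∩ g(V)) · #(ker f ∩ U) · #(ker g ∩ V)`; **`pow_two_mul_dvd_natCard_of_ladders_map_of_disjoint_of_even`**:
  `#(ker f ∩ U) ∣ 2` (genus class), `ker g ∩ V = 0`, disjoint images, `v₂ #S` even ⟹ `2^{2·M 0} ∣ #S`.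
So the honest K-side replacement of J is the DISJOINTNESS of the two Kolyvagin spans in `Ш(E_K)` (equivalently: their `2`-socles meet
trivially) — a property of the exhibited classes, to be SUPPLIED (cross-parity avoidance at level `2`), not counted.

References: [McCallumLMS1991] §5 Thm. 5.4 (the eigenspace count at odd `p`, where `U ∩ V = 0` is automatic); [Kolyvagin1991StructureSha];
[GrossLMS1991] Prop. 5.4 (signs).
-/

set_option autoImplicit false
-- the Theorems namespace of this sub repeats the summit name by design (D-0017 nested layout)
set_option linter.dupNamespace false

noncomputable section

open scoped Classical

universe u

namespace Summit.BirchSwinnertonDyer.BirchSwinnertonDyer.Theorems.GenusExact.PlusDescent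

/-! ## §1 Two ladders in two subgroups: the loss is `#(U ∩ V)` -/

section Abstract

variable {A : Type u} [AddCommGroup A]

/-- `#U · #V = #(U ⊔ V) · #(U ⊓ V)` for subgroups of an abelian group (second isomorphism theorem, as index bookkeeping:
`[U ⊔ V : U] = [V : U ⊓ V]`). [folklore] -/
theorem natCard_mul_natCard_eq_natCard_sup_mul_natCard_inf (U V : AddSubgroup A) :
    Nat.card U * Nat.card V = Nat.card ↥(U ⊔ V) * Nat.card ↥(U ⊓ V) := by
  -- `#U · [U ⊔ V : U] = #(U ⊔ V)` and `#(U ⊓ V) · [V : U ⊓ V] = #V`, with `[U ⊔ V : U] = [V : U] = [V : U ⊓ V]`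
  have h1 : Nat.card U * U.relIndex (U ⊔ V) = Nat.card ↥(U ⊔ V) := by
    rw [← AddSubgroup.relIndex_bot_left U, ← AddSubgroup.relIndex_bot_left (U ⊔ V)]
    exact AddSubgroup.relIndex_mul_relIndex ⊥ U (U ⊔ V) bot_le le_sup_left
  have h2 : Nat.card ↥(U ⊓ V) * (U ⊓ V).relIndex V = Nat.card V := by
    rw [← AddSubgroup.relIndex_bot_left (U ⊓ V), ← AddSubgroup.relIndex_bot_left V]
    exact AddSubgroup.relIndex_mul_relIndex ⊥ (U ⊓ V) V bot_le inf_le_right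
  have h3 : U.relIndex (U ⊔ V) = (U ⊓ V).relIndex V := by
    rw [AddSubgroup.relIndex_sup_left, AddSubgroup.inf_relIndex_right]
  rw [← h1, ← h2, h3]
  ring

/-- **Two ladders in two subgroups exhibit `p^{2Σ a}` inside `#A · #(U ∩ V)`.**  `A` finite abelian, `p` prime, `U, V ≤ A`; if for every
`m < T` there are `2m+2` independent elements of `U` of order `p^{a(2m)}` and `2m+2` independent elements of `V` of order `p^{a(2m+1)}`, then
`p^{2 Σ_{j<2T} a j} ∣ #A · #(U ⊓ V)` (`p^{2Σ_even} ∣ #U`, `p^{2Σ_odd} ∣ #V`, `#U·#V = #(U ⊔ V)·#(U ⊓ V)`, `#(U ⊔ V) ∣ #A`).  At odd `p` with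
`U ≤ A^{τ=+1}`, `V ≤ A^{τ=−1}` the factor `#(U ⊓ V)` is `1` (McCallum's count); at `p = 2` it is the exact loss.
[cite: McCallumLMS1991, §5 Thm. 5.4] -/
theorem pow_two_mul_sum_dvd_natCard_mul_natCard_inf_of_ladders [Finite A] {p : ℕ} (hp : p.Prime) (T : ℕ) (a : ℕ → ℕ)
    (U V : AddSubgroup A)
    (hU : ∀ m < T, ∃ x : Fin (2 * m + 2) → A, (∀ i, x i ∈ U) ∧ (∀ i, addOrderOf (x i) = p ^ a (2 * m)) ∧
      ∀ c : Fin (2 * m + 2) → ℤ, ∑ i, c i • x i = 0 → ∀ i, ((p ^ a (2 * m) : ℕ) : ℤ) ∣ c i)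
    (hV : ∀ m < T, ∃ x : Fin (2 * m + 2) → A, (∀ i, x i ∈ V) ∧ (∀ i, addOrderOf (x i) = p ^ a (2 * m + 1)) ∧
      ∀ c : Fin (2 * m + 2) → ℤ, ∑ i, c i • x i = 0 → ∀ i, ((p ^ a (2 * m + 1) : ℕ) : ℤ) ∣ c i) :
    p ^ (2 * ∑ j ∈ Finset.range (2 * T), a j) ∣ Nat.card A * Nat.card ↥(U ⊓ V) := by
  have hU' : ∀ m < T, ∃ x : Fin (2 * m + 2) → U, (∀ i, addOrderOf (x i) = p ^ a (2 * m)) ∧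
      ∀ c : Fin (2 * m + 2) → ℤ, ∑ i, c i • x i = 0 → ∀ i, ((p ^ a (2 * m) : ℕ) : ℤ) ∣ c i := fun m hm ↦ by
    obtain ⟨x, hmem, hord, hind⟩ := hU m hm
    exact exists_indepFamily_subtype x hmem hord hind
  have hV' : ∀ m < T, ∃ x : Fin (2 * m + 2) → V, (∀ i, addOrderOf (x i) = p ^ a (2 * m + 1)) ∧
      ∀ c : Fin (2 * m + 2) → ℤ, ∑ i, c i • x i = 0 → ∀ i, ((p ^ a (2 * m + 1) : ℕ) : ℤ) ∣ c i := fun m hm ↦ by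
    obtain ⟨x, hmem, hord, hind⟩ := hV m hm
    exact exists_indepFamily_subtype x hmem hord hind
  have h := pow_two_mul_sum_dvd_natCard_mul_of_twinLadder (Ap := U) (Am := V) hp T a hU' hV'
  rw [natCard_mul_natCard_eq_natCard_sup_mul_natCard_inf U V] at h
  exact h.trans (mul_dvd_mul_right (AddSubgroup.card_addSubgroup_dvd_card (U ⊔ V)) _)

/-- **Ladder form.**  With an antitone ladder `M` and `M (2T) = 0`, families of order `p^{M(2m) − M(2m+1)}` in `U` and `p^{M(2m+1) − M(2m+2)}`
in `V`: `p^{2·M 0} ∣ #A · #(U ⊓ V)`. [cite: McCallumLMS1991, §5 Thm. 5.4] -/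
theorem pow_two_mul_dvd_natCard_mul_natCard_inf_of_ladders [Finite A] {p : ℕ} (hp : p.Prime) (T : ℕ) (M : ℕ → ℕ)
    (hM : ∀ j, M (j + 1) ≤ M j) (hMT : M (2 * T) = 0) (U V : AddSubgroup A)
    (hU : ∀ m < T, ∃ x : Fin (2 * m + 2) → A, (∀ i, x i ∈ U) ∧ (∀ i, addOrderOf (x i) = p ^ (M (2 * m) - M (2 * m + 1))) ∧
      ∀ c : Fin (2 * m + 2) → ℤ, ∑ i, c i • x i = 0 → ∀ i, ((p ^ (M (2 * m) - M (2 * m + 1)) : ℕ) : ℤ) ∣ c i)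
    (hV : ∀ m < T, ∃ x : Fin (2 * m + 2) → A, (∀ i, x i ∈ V) ∧
      (∀ i, addOrderOf (x i) = p ^ (M (2 * m + 1) - M (2 * m + 2))) ∧
      ∀ c : Fin (2 * m + 2) → ℤ, ∑ i, c i • x i = 0 → ∀ i, ((p ^ (M (2 * m + 1) - M (2 * m + 2)) : ℕ) : ℤ) ∣ c i) :
    p ^ (2 * M 0) ∣ Nat.card A * Nat.card ↥(U ⊓ V) := by
  have h := pow_two_mul_sum_dvd_natCard_mul_natCard_inf_of_ladders hp T (fun j ↦ M j - M (j + 1)) U V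
    (fun m hm ↦ hU m hm) (fun m hm ↦ by
      obtain ⟨x, hmem, hord, hind⟩ := hV m hm
      exact ⟨x, hmem, fun i ↦ by rw [hord i], fun c hc i ↦ by simpa using hind c hc i⟩)
  rwa [sum_range_sub_eq_of_antitone M hM, hMT, Nat.sub_zero] at h

/-- **Valuation form: the loss is `v_p #(U ∩ V)`.**  Same data: `2·M 0 ≤ v_p #A + v_p #(U ⊓ V)`.  Compare: the two-sided ℚ-frame loses
the genus budget `B − 1`, the eigen-count J_K loses `v_p #H¹(C₂, A)`; here the loss is carried by the two exhibited spans only.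
[cite: McCallumLMS1991, §5 Thm. 5.4] -/
theorem two_mul_le_padicValNat_add_padicValNat_inf_of_ladders [Finite A] {p : ℕ} [hp : Fact p.Prime] (T : ℕ) (M : ℕ → ℕ)
    (hM : ∀ j, M (j + 1) ≤ M j) (hMT : M (2 * T) = 0) (U V : AddSubgroup A)
    (hU : ∀ m < T, ∃ x : Fin (2 * m + 2) → A, (∀ i, x i ∈ U) ∧ (∀ i, addOrderOf (x i) = p ^ (M (2 * m) - M (2 * m + 1))) ∧
      ∀ c : Fin (2 * m + 2) → ℤ, ∑ i, c i • x i = 0 → ∀ i, ((p ^ (M (2 * m) - M (2 * m + 1)) : ℕ) : ℤ) ∣ c i)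
    (hV : ∀ m < T, ∃ x : Fin (2 * m + 2) → A, (∀ i, x i ∈ V) ∧
      (∀ i, addOrderOf (x i) = p ^ (M (2 * m + 1) - M (2 * m + 2))) ∧
      ∀ c : Fin (2 * m + 2) → ℤ, ∑ i, c i • x i = 0 → ∀ i, ((p ^ (M (2 * m + 1) - M (2 * m + 2)) : ℕ) : ℤ) ∣ c i) :
    2 * M 0 ≤ padicValNat p (Nat.card A) + padicValNat p (Nat.card ↥(U ⊓ V)) := by
  have h := pow_two_mul_dvd_natCard_mul_natCard_inf_of_ladders hp.out T M hM hMT U V hU hV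
  have hA : Nat.card A ≠ 0 := Nat.card_pos.ne'
  have hI : Nat.card ↥(U ⊓ V) ≠ 0 := Nat.card_pos.ne'
  rw [padicValNat_dvd_iff_le (mul_ne_zero hA hI), padicValNat.mul hA hI] at h
  exact h

/-- **DISJOINT spans: no loss.**  If the span of the `U`-families meets the span of the `V`-families trivially (`U ⊓ V = ⊥`), then
`p^{2·M 0} ∣ #A` — Kolyvagin's structure-theorem count, valid at `p = 2` under exactly this hypothesis (at odd `p` it is the eigenspace
decomposition). [cite: McCallumLMS1991, §5 Thm. 5.4] [cite: Kolyvagin1991StructureSha] -/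
theorem pow_two_mul_dvd_natCard_of_disjoint_ladders [Finite A] {p : ℕ} (hp : p.Prime) (T : ℕ) (M : ℕ → ℕ)
    (hM : ∀ j, M (j + 1) ≤ M j) (hMT : M (2 * T) = 0) (U V : AddSubgroup A) (hUV : Disjoint U V)
    (hU : ∀ m < T, ∃ x : Fin (2 * m + 2) → A, (∀ i, x i ∈ U) ∧ (∀ i, addOrderOf (x i) = p ^ (M (2 * m) - M (2 * m + 1))) ∧
      ∀ c : Fin (2 * m + 2) → ℤ, ∑ i, c i • x i = 0 → ∀ i, ((p ^ (M (2 * m) - M (2 * m + 1)) : ℕ) : ℤ) ∣ c i)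
    (hV : ∀ m < T, ∃ x : Fin (2 * m + 2) → A, (∀ i, x i ∈ V) ∧
      (∀ i, addOrderOf (x i) = p ^ (M (2 * m + 1) - M (2 * m + 2))) ∧
      ∀ c : Fin (2 * m + 2) → ℤ, ∑ i, c i • x i = 0 → ∀ i, ((p ^ (M (2 * m + 1) - M (2 * m + 2)) : ℕ) : ℤ) ∣ c i) :
    p ^ (2 * M 0) ∣ Nat.card A := by
  have h := pow_two_mul_dvd_natCard_mul_natCard_inf_of_ladders hp T M hM hMT U V hU hV
  rwa [disjoint_iff.mp hUV, AddSubgroup.card_bot, mul_one] at h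

end Abstract

/-! ## §2 L_T's currency: two ladders inside `Ш(E/F)` -/

section Sha

open WeierstrassCurve

variable {F : Type u} [Field F] [NumberField F] (V : WeierstrassCurve F)

/-- Bookkeeping: an independent family of `H¹(F, E)` lying in `Ш(E/F)` and in a subgroup `U`, of `2`-power order, is an independent family
of `Ш(E/F)[2^∞]` lying in the pull-back of `U`. [folklore] -/
theorem exists_indepFamily_primaryComponent_sha_of_mem {n a : ℕ} (U : AddSubgroup V.galH1) (x : Fin n → V.galH1)
    (hsha : ∀ i, x i ∈ V.sha) (hU : ∀ i, x i ∈ U) (hord : ∀ i, addOrderOf (x i) = 2 ^ a)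
    (hind : ∀ c : Fin n → ℤ, ∑ i, c i • x i = 0 → ∀ i, ((2 ^ a : ℕ) : ℤ) ∣ c i) :
    ∃ y : Fin n → AddCommGroup.primaryComponent V.sha 2,
      (∀ i, y i ∈ U.comap (V.sha.subtype.comp (AddCommGroup.primaryComponent V.sha 2).subtype)) ∧
      (∀ i, addOrderOf (y i) = 2 ^ a) ∧ ∀ c : Fin n → ℤ, ∑ i, c i • y i = 0 → ∀ i, ((2 ^ a : ℕ) : ℤ) ∣ c i := by
  have hmemP : ∀ i, (⟨x i, hsha i⟩ : V.sha) ∈ AddCommGroup.primaryComponent V.sha 2 := fun i ↦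
    (AddCommGroup.mem_primaryComponent).mpr ⟨a, Subtype.ext (by
      have h := addOrderOf_nsmul_eq_zero (x i)
      rw [hord i] at h
      simpa using h)⟩
  let y : Fin n → AddCommGroup.primaryComponent V.sha 2 := fun i ↦ ⟨⟨x i, hsha i⟩, hmemP i⟩
  let j : AddCommGroup.primaryComponent V.sha 2 →+ V.galH1 :=
    V.sha.subtype.comp (AddCommGroup.primaryComponent V.sha 2).subtype
  have hj : Function.Injective j :=
    V.sha.subtype_injective.comp (AddCommGroup.primaryComponent V.sha 2).subtype_injective
  have hjy : ∀ i, j (y i) = x i := fun _ ↦ rfl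
  refine ⟨y, fun i ↦ ?_, fun i ↦ ?_, fun c hc ↦ ?_⟩
  · rw [AddSubgroup.mem_comap]
    exact hU i
  · rw [← addOrderOf_injective j hj (y i), hjy, hord]
  · refine hind c ?_
    have h := congrArg j hc
    rw [map_sum, map_zero] at h
    simpa only [map_zsmul, hjy] using h

/-- The pull-back of `U ⊓ U′` to `Ш(E/F)[2^∞]` injects into `U ⊓ U′`, so its order divides `#(U ⊓ U′)`. [folklore] -/
theorem natCard_comap_inf_dvd (U U' : AddSubgroup V.galH1) :
    Nat.card ↥(U.comap (V.sha.subtype.comp (AddCommGroup.primaryComponent V.sha 2).subtype) ⊓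
        U'.comap (V.sha.subtype.comp (AddCommGroup.primaryComponent V.sha 2).subtype)) ∣ Nat.card ↥(U ⊓ U') := by
  set j : AddCommGroup.primaryComponent V.sha 2 →+ V.galH1 :=
    V.sha.subtype.comp (AddCommGroup.primaryComponent V.sha 2).subtype with hjdef
  have hj : Function.Injective j :=
    V.sha.subtype_injective.comp (AddCommGroup.primaryComponent V.sha 2).subtype_injective
  rw [← AddSubgroup.comap_inf]
  -- the restriction of `j` to `comap j (U ⊓ U')`, with values in `U ⊓ U'`
  let f : ↥((U ⊓ U').comap j) →+ ↥(U ⊓ U') :=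
    (j.comp ((U ⊓ U').comap j).subtype).codRestrict (U ⊓ U') fun z ↦ by
      simpa only [AddMonoidHom.coe_comp, AddSubgroup.coe_subtype, Function.comp_apply, AddSubgroup.mem_comap] using z.2
  have hf : Function.Injective f := by
    intro z₁ z₂ h
    have h' : j z₁ = j z₂ := by simpa [f] using congrArg Subtype.val h
    exact Subtype.ext (hj h')
  exact AddSubgroup.card_dvd_of_injective f hf

/-- **Two ladders in `Ш(E/F)`: the loss is `#(U ∩ U′)`.**  `E/F` over a number field with `Ш(E/F)[2^∞]` finite; `U, U′ ≤ H¹(F, E)`; an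
antitone ladder `M` with `M (2T) = 0`; for each `m < T`, `2m+2` independent classes of `Ш(E/F) ∩ U` of order `2^{M(2m) − M(2m+1)}` and `2m+2`
independent classes of `Ш(E/F) ∩ U′` of order `2^{M(2m+1) − M(2m+2)}`.  Then `2^{2·M 0} ∣ #Ш(E/F)[2^∞] · #(U ⊓ U′)`.  (Intended: `F = K`,
`E = W_K`, `U` / `U′` the spans of the (+)- / (−)-Kolyvagin classes `d_M(n)` at the odd / even rungs.) [cite: McCallumLMS1991, §5 Thm. 5.4] -/
theorem pow_two_mul_dvd_natCard_sha_mul_natCard_inf_of_ladders [Finite (AddCommGroup.primaryComponent V.sha 2)]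
    (U U' : AddSubgroup V.galH1) (T : ℕ) (M : ℕ → ℕ) (hM : ∀ j, M (j + 1) ≤ M j) (hMT : M (2 * T) = 0)
    (hfam : ∀ m < T, ∃ x : Fin (2 * m + 2) → V.galH1, (∀ i, x i ∈ V.sha) ∧ (∀ i, x i ∈ U) ∧
      (∀ i, addOrderOf (x i) = 2 ^ (M (2 * m) - M (2 * m + 1))) ∧
      ∀ c : Fin (2 * m + 2) → ℤ, ∑ i, c i • x i = 0 → ∀ i, ((2 ^ (M (2 * m) - M (2 * m + 1)) : ℕ) : ℤ) ∣ c i)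
    (hfam' : ∀ m < T, ∃ x : Fin (2 * m + 2) → V.galH1, (∀ i, x i ∈ V.sha) ∧ (∀ i, x i ∈ U') ∧
      (∀ i, addOrderOf (x i) = 2 ^ (M (2 * m + 1) - M (2 * m + 2))) ∧
      ∀ c : Fin (2 * m + 2) → ℤ, ∑ i, c i • x i = 0 → ∀ i, ((2 ^ (M (2 * m + 1) - M (2 * m + 2)) : ℕ) : ℤ) ∣ c i) :
    2 ^ (2 * M 0) ∣ Nat.card (AddCommGroup.primaryComponent V.sha 2) * Nat.card ↥(U ⊓ U') := by
  set j : AddCommGroup.primaryComponent V.sha 2 →+ V.galH1 :=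
    V.sha.subtype.comp (AddCommGroup.primaryComponent V.sha 2).subtype with hjdef
  have h := pow_two_mul_dvd_natCard_mul_natCard_inf_of_ladders (A := AddCommGroup.primaryComponent V.sha 2) Nat.prime_two T M
    hM hMT (U.comap j) (U'.comap j)
    (fun m hm ↦ by
      obtain ⟨x, hsha, hU, hord, hind⟩ := hfam m hm
      exact exists_indepFamily_primaryComponent_sha_of_mem V U x hsha hU hord hind)
    (fun m hm ↦ by
      obtain ⟨x, hsha, hU, hord, hind⟩ := hfam' m hm
      exact exists_indepFamily_primaryComponent_sha_of_mem V U' x hsha hU hord hind)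
  exact h.trans (mul_dvd_mul_left _ (natCard_comap_inf_dvd V U U'))

/-- **DISJOINT KOLYVAGIN SPANS GIVE L_T's CONCLUSION VERBATIM.**  Same data with `Disjoint U U′`: `2^{2·M 0} ∣ #Ш(E/F)[2^∞]` — for
`F = K`, `E = W_K`, `M 0 = M₀` this is `2 ^ (2 * M₀) ∣ Nat.card (Ш(W_K/K)[2^∞])`, the conclusion of the crux L_T `PowDvdShaCardAtTwoRT`,
with no genus budget `ord₂ C(Wd)`, no Milne defect identity and no Cassels–Tate parity.  What is owed is the DISJOINTNESS of the two spans
(at odd `p`: eigenspaces; at `2`: cross-parity avoidance of the level-`2` socles). [cite: McCallumLMS1991, §5 Thm. 5.4]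
[cite: Kolyvagin1991StructureSha] -/
theorem pow_two_mul_dvd_natCard_sha_of_disjoint_ladders [Finite (AddCommGroup.primaryComponent V.sha 2)]
    (U U' : AddSubgroup V.galH1) (hUU' : Disjoint U U') (T : ℕ) (M : ℕ → ℕ) (hM : ∀ j, M (j + 1) ≤ M j) (hMT : M (2 * T) = 0)
    (hfam : ∀ m < T, ∃ x : Fin (2 * m + 2) → V.galH1, (∀ i, x i ∈ V.sha) ∧ (∀ i, x i ∈ U) ∧
      (∀ i, addOrderOf (x i) = 2 ^ (M (2 * m) - M (2 * m + 1))) ∧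
      ∀ c : Fin (2 * m + 2) → ℤ, ∑ i, c i • x i = 0 → ∀ i, ((2 ^ (M (2 * m) - M (2 * m + 1)) : ℕ) : ℤ) ∣ c i)
    (hfam' : ∀ m < T, ∃ x : Fin (2 * m + 2) → V.galH1, (∀ i, x i ∈ V.sha) ∧ (∀ i, x i ∈ U') ∧
      (∀ i, addOrderOf (x i) = 2 ^ (M (2 * m + 1) - M (2 * m + 2))) ∧
      ∀ c : Fin (2 * m + 2) → ℤ, ∑ i, c i • x i = 0 → ∀ i, ((2 ^ (M (2 * m + 1) - M (2 * m + 2)) : ℕ) : ℤ) ∣ c i) :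
    2 ^ (2 * M 0) ∣ Nat.card (AddCommGroup.primaryComponent V.sha 2) := by
  have h := pow_two_mul_dvd_natCard_sha_mul_natCard_inf_of_ladders V U U' T M hM hMT hfam hfam'
  rwa [disjoint_iff.mp hUU', AddSubgroup.card_bot, mul_one] at h

end Sha

/-! ## §3 Ladders given UPSTAIRS (ℚ-side): transport through homomorphisms with small kernel

gk2-p4 g17, second instalment.  The two ladders of stub L live in `H¹(ℚ, W)` and `H¹(ℚ, Wd)`; they reach `A ⊇ Ш(W_K)[2^∞]` through
`f = res_K` (kernel: the genus class of the Mordell–Weil generator, order `2` — gk2-p2 `…RTGenusKernel`) and `g = ` twist iso `∘ res_K`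
(injective — gk2-p2 `…RTGenusKernelTwin`).  The count below charges exactly: the target group, the intersection of the two IMAGES, and the
parts of the two kernels met by the spans; with `#(ker f ∩ U) ∣ 2`, `ker g ∩ V = 0`, disjoint images and `v₂ #Ш(W_K)[2^∞]` even
(Cassels–Tate over `K`) the `g₀`-bit is refunded and L_T's `2^{2M₀} ∣ #Ш(W_K)[2^∞]` follows. -/

section Transport

variable {A : Type u} [AddCommGroup A] {G₁ : Type u} [AddCommGroup G₁] {G₂ : Type u} [AddCommGroup G₂]

/-- `#U = #(ker f ∩ U) · #f(U)` (first isomorphism theorem for `f|_U`, as index bookkeeping). [folklore] -/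
theorem natCard_eq_natCard_ker_inf_mul_natCard_map (f : G₁ →+ A) (U : AddSubgroup G₁) :
    Nat.card U = Nat.card ↥(f.ker ⊓ U) * Nat.card (U.map f) := by
  rw [← AddSubgroup.relIndex_ker, ← AddSubgroup.inf_relIndex_right, ← AddSubgroup.relIndex_bot_left (f.ker ⊓ U),
    ← AddSubgroup.relIndex_bot_left U]
  exact (AddSubgroup.relIndex_mul_relIndex ⊥ (f.ker ⊓ U) U bot_le inf_le_right).symm

/-- **Transport-tolerant two-ladder count.**  `p` prime; homomorphisms `f : G₁ → A`, `g : G₂ → A`; finite subgroups `U ≤ G₁`, `V ≤ G₂`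
whose images lie in a finite subgroup `S ≤ A`; for every `m < T`, `2m+2` independent elements of `U` of order `p^{a(2m)}` and `2m+2`
independent elements of `V` of order `p^{a(2m+1)}` (independence UPSTAIRS).  Then
`p^{2 Σ_{j<2T} a j} ∣ #S · #(f(U) ∩ g(V)) · (#(ker f ∩ U) · #(ker g ∩ V))`.  (L_T: `G₁ = H¹(ℚ, W)`, `G₂ = H¹(ℚ, Wd)`, `S = Ш(W_K)[2^∞]`.)
[cite: McCallumLMS1991, §5 Thm. 5.4] -/
theorem pow_two_mul_sum_dvd_natCard_mul_of_ladders_map {p : ℕ} (hp : p.Prime) (T : ℕ) (a : ℕ → ℕ)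
    (f : G₁ →+ A) (g : G₂ →+ A) (U : AddSubgroup G₁) (V : AddSubgroup G₂) [Finite U] [Finite V]
    (S : AddSubgroup A) [Finite S] (hfU : U.map f ≤ S) (hgV : V.map g ≤ S)
    (hU : ∀ m < T, ∃ x : Fin (2 * m + 2) → G₁, (∀ i, x i ∈ U) ∧ (∀ i, addOrderOf (x i) = p ^ a (2 * m)) ∧
      ∀ c : Fin (2 * m + 2) → ℤ, ∑ i, c i • x i = 0 → ∀ i, ((p ^ a (2 * m) : ℕ) : ℤ) ∣ c i)
    (hV : ∀ m < T, ∃ x : Fin (2 * m + 2) → G₂, (∀ i, x i ∈ V) ∧ (∀ i, addOrderOf (x i) = p ^ a (2 * m + 1)) ∧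
      ∀ c : Fin (2 * m + 2) → ℤ, ∑ i, c i • x i = 0 → ∀ i, ((p ^ a (2 * m + 1) : ℕ) : ℤ) ∣ c i) :
    p ^ (2 * ∑ j ∈ Finset.range (2 * T), a j) ∣
      Nat.card S * Nat.card ↥(U.map f ⊓ V.map g) * (Nat.card ↥(f.ker ⊓ U) * Nat.card ↥(g.ker ⊓ V)) := by
  -- the two one-sided counts upstairs
  have hU' : ∀ m < T, ∃ x : Fin (2 * m + 2) → U, (∀ i, addOrderOf (x i) = p ^ a (2 * m)) ∧
      ∀ c : Fin (2 * m + 2) → ℤ, ∑ i, c i • x i = 0 → ∀ i, ((p ^ a (2 * m) : ℕ) : ℤ) ∣ c i := fun m hm ↦ by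
    obtain ⟨x, hmem, hord, hind⟩ := hU m hm
    exact exists_indepFamily_subtype x hmem hord hind
  have hV' : ∀ m < T, ∃ x : Fin (2 * m + 2) → V, (∀ i, addOrderOf (x i) = p ^ a (2 * m + 1)) ∧
      ∀ c : Fin (2 * m + 2) → ℤ, ∑ i, c i • x i = 0 → ∀ i, ((p ^ a (2 * m + 1) : ℕ) : ℤ) ∣ c i := fun m hm ↦ by
    obtain ⟨x, hmem, hord, hind⟩ := hV m hm
    exact exists_indepFamily_subtype x hmem hord hind
  have h := pow_two_mul_sum_dvd_natCard_mul_of_twinLadder (Ap := U) (Am := V) hp T a hU' hV'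
  -- `#U · #V = #(ker f ∩ U) · #(ker g ∩ V) · #(fU ⊔ gV) · #(fU ⊓ gV)` and `#(fU ⊔ gV) ∣ #S`
  rw [natCard_eq_natCard_ker_inf_mul_natCard_map f U, natCard_eq_natCard_ker_inf_mul_natCard_map g V,
    show Nat.card ↥(f.ker ⊓ U) * Nat.card ↥(U.map f) * (Nat.card ↥(g.ker ⊓ V) * Nat.card ↥(V.map g)) =
      Nat.card ↥(U.map f) * Nat.card ↥(V.map g) * (Nat.card ↥(f.ker ⊓ U) * Nat.card ↥(g.ker ⊓ V)) by ring,
    natCard_mul_natCard_eq_natCard_sup_mul_natCard_inf (U.map f) (V.map g)] at h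
  refine h.trans (mul_dvd_mul_right (mul_dvd_mul_right ?_ _) _)
  exact AddSubgroup.card_dvd_of_le (sup_le hfU hgV)

/-- **Ladder form.**  With an antitone `M`, `M (2T) = 0`, orders `p^{M(2m) − M(2m+1)}` in `U` and `p^{M(2m+1) − M(2m+2)}` in `V`:
`p^{2·M 0} ∣ #S · #(f(U) ∩ g(V)) · (#(ker f ∩ U) · #(ker g ∩ V))`. [cite: McCallumLMS1991, §5 Thm. 5.4] -/
theorem pow_two_mul_dvd_natCard_mul_of_ladders_map {p : ℕ} (hp : p.Prime) (T : ℕ) (M : ℕ → ℕ)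
    (hM : ∀ j, M (j + 1) ≤ M j) (hMT : M (2 * T) = 0)
    (f : G₁ →+ A) (g : G₂ →+ A) (U : AddSubgroup G₁) (V : AddSubgroup G₂) [Finite U] [Finite V]
    (S : AddSubgroup A) [Finite S] (hfU : U.map f ≤ S) (hgV : V.map g ≤ S)
    (hU : ∀ m < T, ∃ x : Fin (2 * m + 2) → G₁, (∀ i, x i ∈ U) ∧ (∀ i, addOrderOf (x i) = p ^ (M (2 * m) - M (2 * m + 1))) ∧
      ∀ c : Fin (2 * m + 2) → ℤ, ∑ i, c i • x i = 0 → ∀ i, ((p ^ (M (2 * m) - M (2 * m + 1)) : ℕ) : ℤ) ∣ c i)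
    (hV : ∀ m < T, ∃ x : Fin (2 * m + 2) → G₂, (∀ i, x i ∈ V) ∧
      (∀ i, addOrderOf (x i) = p ^ (M (2 * m + 1) - M (2 * m + 2))) ∧
      ∀ c : Fin (2 * m + 2) → ℤ, ∑ i, c i • x i = 0 → ∀ i, ((p ^ (M (2 * m + 1) - M (2 * m + 2)) : ℕ) : ℤ) ∣ c i) :
    p ^ (2 * M 0) ∣ Nat.card S * Nat.card ↥(U.map f ⊓ V.map g) * (Nat.card ↥(f.ker ⊓ U) * Nat.card ↥(g.ker ⊓ V)) := by
  have h := pow_two_mul_sum_dvd_natCard_mul_of_ladders_map hp T (fun j ↦ M j - M (j + 1)) f g U V S hfU hgV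
    (fun m hm ↦ hU m hm) (fun m hm ↦ by
      obtain ⟨x, hmem, hord, hind⟩ := hV m hm
      exact ⟨x, hmem, fun i ↦ by rw [hord i], fun c hc i ↦ by simpa using hind c hc i⟩)
  rwa [sum_range_sub_eq_of_antitone M hM, hMT, Nat.sub_zero] at h

/-- **The `g₀`-bit refunded by parity (`p = 2`).**  Same data at `p = 2`; if the (+)-span meets `ker f` in at most `2` elements (the genus
class), `g` is injective on the (−)-span, the two images are DISJOINT, and `v₂ #S` is EVEN (Cassels–Tate over `K` for `S = Ш(W_K)[2^∞]`), then
`2^{2·M 0} ∣ #S` — L_T's conclusion from ℚ-side ladders. [cite: McCallumLMS1991, §5 Thm. 5.4] [cite: Kolyvagin1991StructureSha] -/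
theorem pow_two_mul_dvd_natCard_of_ladders_map_of_disjoint_of_even (T : ℕ) (M : ℕ → ℕ)
    (hM : ∀ j, M (j + 1) ≤ M j) (hMT : M (2 * T) = 0)
    (f : G₁ →+ A) (g : G₂ →+ A) (U : AddSubgroup G₁) (V : AddSubgroup G₂) [Finite U] [Finite V]
    (S : AddSubgroup A) [Finite S] (hfU : U.map f ≤ S) (hgV : V.map g ≤ S)
    (hker₁ : Nat.card ↥(f.ker ⊓ U) ∣ 2) (hker₂ : g.ker ⊓ V = ⊥) (hdis : Disjoint (U.map f) (V.map g))
    (heven : Even (padicValNat 2 (Nat.card S)))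
    (hU : ∀ m < T, ∃ x : Fin (2 * m + 2) → G₁, (∀ i, x i ∈ U) ∧ (∀ i, addOrderOf (x i) = 2 ^ (M (2 * m) - M (2 * m + 1))) ∧
      ∀ c : Fin (2 * m + 2) → ℤ, ∑ i, c i • x i = 0 → ∀ i, ((2 ^ (M (2 * m) - M (2 * m + 1)) : ℕ) : ℤ) ∣ c i)
    (hV : ∀ m < T, ∃ x : Fin (2 * m + 2) → G₂, (∀ i, x i ∈ V) ∧
      (∀ i, addOrderOf (x i) = 2 ^ (M (2 * m + 1) - M (2 * m + 2))) ∧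
      ∀ c : Fin (2 * m + 2) → ℤ, ∑ i, c i • x i = 0 → ∀ i, ((2 ^ (M (2 * m + 1) - M (2 * m + 2)) : ℕ) : ℤ) ∣ c i) :
    2 ^ (2 * M 0) ∣ Nat.card S := by
  haveI : Fact (Nat.Prime 2) := ⟨Nat.prime_two⟩
  have h := pow_two_mul_dvd_natCard_mul_of_ladders_map Nat.prime_two T M hM hMT f g U V S hfU hgV hU hV
  rw [disjoint_iff.mp hdis, hker₂, AddSubgroup.card_bot, AddSubgroup.card_bot, mul_one, mul_one] at h
  -- `2^{2M₀} ∣ #S · k` with `k ∣ 2`, hence `2^{2M₀} ∣ 2 · #S`; parity of `v₂ #S` removes the extra factor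
  have h2 : 2 ^ (2 * M 0) ∣ Nat.card S * 2 := h.trans (mul_dvd_mul_left _ hker₁)
  have hS : Nat.card S ≠ 0 := Nat.card_pos.ne'
  rw [padicValNat_dvd_iff_le (mul_ne_zero hS two_ne_zero), padicValNat.mul hS two_ne_zero, padicValNat.self one_lt_two] at h2
  rw [padicValNat_dvd_iff_le hS]
  obtain ⟨r, hr⟩ := heven
  omega

end Transport

end Summit.BirchSwinnertonDyer.BirchSwinnertonDyer.Theorems.GenusExact.PlusDescent

end
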